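import Literature.MathematicalPhysics.QuantumFieldTheory.Balaban1983to89.T4ShellMeasurePolar

/-!
# `T4Continuum.ShellMeasureWitness` — a JOINT INHABITATION WITNESS of the analytic member of the NE7c shell-measure
# frame: `T4ShellMeasurePolar.slotAntiConcentration_withDensity` ∘ `T4ShellMeasureAnalytic.fibreAlternative_of_analytic_family`
# with EVERY binder discharged on ONE explicit small-field Gaussian block model, ending in an honest
# `T4ShellMeasure.SlotAntiConcentration` with an explicit constant (cell `pub-balaban`, sub-cell `t4`, spine estimate
# NE7c (node U5b), fan-out lineage t4-ne7c-p1 = PROVER seat P1 «shell-measure route», generation 18; tree target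
# `Summits/QuantumFields/BalabanUV/T4Continuum/Support/`; ADDITIVE — imports the Literature leaf `T4ShellMeasurePolar`
# ONLY and modifies nothing)

HONEST FRAMING.  Finite four-torus programme, rung (B)+1 only — NOT infinite volume, NOT a mass gap, NOT the Clay
problem, NOT summit progress; (B), `BetaPertHyp`, (B^μ) are not mentioned because nothing here consumes them.  THIS
MODULE IS A TOY: it encodes NOTHING of Bałaban's effective densities; the cell wall of NE7c — (M1)
`T4ShellMeasure.SlotAntiConcentration` FOR BAŁABAN'S INDUCTIVELY DEFINED MEASURES — is NOT PRINTED in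
[Balaban 1983–89] (GAPS G-ne7cp1-1, record `t4/T4-EST-NE7c-P1.md` §4), asserted by nobody, and untouched by this file.
Every declaration is [folklore] kernel mathematics, 0 sorry, 0 citations (no `[cite:]` tag: nothing printed is
transcribed; genre precedents `PrecisionDecayWitness`, `T4TrajectoryDensityWitness`).

WHY THIS LEAF.  The shell-measure route is typed end to end in twelve Literature leaves (`T4ShellMeasure` …
`T4ShellMeasureDet`) whose every analytic input is a binder, and whose probes are PER-BINDER (planted-false checks,
one-shape examples).  The analytic member's hypothesis set — (AN-bound) «analytic and bounded on a disc, vanishing at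
the flat point», the smallness relation (SM) `2·cauchyCoef·x₀² ≤ s·θ(1 − ρ)`, tail support, (DC-fwd) with constant
`B = dim`, the window condition, the presentation of the tested variable as the `sup'` of norm profiles — had no
JOINT witness: no single measure on which all of them hold at once and the chain returns a non-degenerate
anti-concentration bound.  This file is that witness, so the binder set is jointly satisfiable and correctly oriented
(shell of positive mass, transversal AND exceptional fibres both present, no union bound over the two tested
functionals).  VALUE = a consistency certificate for the typed frame; it says NOTHING about whether Bałaban's
densities meet the shapes.

THE TOY.  Configuration space `E3 = ℝ³` (Euclidean), Lebesgue measure; density `dens c = 𝟙{‖x‖ ≤ 1}·exp(−c‖x‖²)`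
(`c ≥ 0`: a small-field characteristic function times a Gaussian); two tested "plaquette" functionals `x ↦ x 0`,
`x ↦ x 1` (the third degree of freedom untested), tested variable `testedVar x = max (|x 0|, |x 1|)` written as a `Finset.sup'`;
threshold `θ = 1/2`, relative width `ρ ∈ [0, 1/2]`.  Per unit direction `ŷ` the plaquette functionals along the
dilation are the ENTIRE functions `w ↦ w·ŷ p` (radius `R = 1001`, bound `H = 1001`, so `cauchyCoef = 9009/10⁶` and
(SM) holds with `s = 1/10`, defect `δ = s/(1 − 2s) = 1/8`); the fibre density is `e^{−3r}·𝟙{r ≥ 0}·exp(−c e^{−2r})`: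
tail-supported below `r₀ = 0` and (DC-fwd) with constant `B = 3` on `[0, ∞)` by
`fwdLogLipschitzOn_radialGaussianModel` BY NAME.  Conclusion (`slotAntiConcentration_toy`): for every `ρ ∈ [0, 1/2]`,
`SlotAntiConcentration (volume.withDensity (dens c)) testedVar (1/2) ρ (2·fibreCoef (1/8) 3 ℓ₀ L)` at the sharpest admissible
`ℓ₀ = −log(1 − ρ)` and the admissible window `L = (9/8)(8ℓ₀/7 + 1/3)`, i.e. shell mass `≤ D(ρ)·ρ·` total mass with
`D(ρ) = (96/7)·exp(1 + (48/7)·(−log(1 − ρ)))` in closed form (`toyCoef_eq`; ≈ 37 as `ρ → 0`, exponential in `Bℓ₀` as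
the phase-space remark of `T4ShellMeasureAnalytic` §8 predicts — a witness of satisfiability, not of sharpness).

RE-CUT v1.1 (courier dry-run `dedup.landed`, journal l.2028): the tested variable is named `testedVar` (v1: `u`) so that the
statements `Continuous testedVar` / `Measurable testedVar` do not print like two unrelated landed lemmas about other files' own `u`;
no mathematics changed.
-/

namespace Summit.QuantumFields.BalabanUV.T4Continuum.ShellMeasureWitness

open MeasureTheory Set Metric
open scoped ENNReal
open Literature.MathematicalPhysics.QuantumFieldTheory.Balaban1983to89
open T4ShellMeasure (SlotAntiConcentration)
open T4ShellMeasureFibre (fibreCoef)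
open T4ShellMeasureAnalytic (FibreAlternative FwdLogLipschitzOn normProfile cauchyCoef
  fibreAlternative_of_analytic_family fwdLogLipschitzOn_radialGaussianModel fibreCoef_window_eq)
open T4ShellMeasurePolar (polarDensity dilate dilate_apply polarDensity_of_norm_eq_one norm_exp_neg_smul
  slotAntiConcentration_withDensity)

noncomputable section

/-! ## §1 The toy: space, tested plaquettes, tested variable, density [folklore] -/

/-- The configuration space of the toy: Euclidean `ℝ³`. [folklore] -/
abbrev E3 : Type := EuclideanSpace ℝ (Fin 3)

/-- The tested "plaquettes": coordinates `0` and `1` of `ℝ³` (coordinate `2` is an untested degree of freedom).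
[folklore] -/
def P : Finset (Fin 3) := {0, 1}

/-- `P` is nonempty. [folklore] -/
theorem P_nonempty : P.Nonempty := ⟨0, by simp [P]⟩

/-- membership in `P`. [folklore] -/
theorem mem_P {p : Fin 3} : p ∈ P ↔ p = 0 ∨ p = 1 := by simp [P]

/-- The tested variable: `testedVar x = max (|x 0|, |x 1|)`, as the `sup'` over the tested plaquettes (no union bound is
ever taken over them downstream). [folklore] -/
def testedVar (x : E3) : ℝ := P.sup' P_nonempty fun p => |x p|

/-- The small-field Gaussian density `𝟙{‖x‖ ≤ 1}·exp(−c‖x‖²)`. [folklore] -/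
def dens (c : ℝ) (x : E3) : ℝ≥0∞ :=
  (closedBall (0 : E3) 1).indicator (fun z => ENNReal.ofReal (Real.exp (-(c * ‖z‖ ^ 2)))) x

/-- The toy measure: Lebesgue measure on `ℝ³` with density `dens c`. [folklore] -/
def μtoy (c : ℝ) : Measure E3 := (volume : Measure E3).withDensity (dens c)

/-- the density is measurable. [folklore] -/
theorem measurable_dens (c : ℝ) : Measurable (dens c) := by
  refine Measurable.indicator ?_ measurableSet_closedBall
  exact ENNReal.measurable_ofReal.comp
    (Real.measurable_exp.comp (measurable_const.mul (measurable_norm.pow_const 2)).neg)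

/-- the tested variable is continuous … [folklore] -/
theorem continuous_testedVar : Continuous testedVar :=
  Continuous.finset_sup'_apply P_nonempty fun p _ =>
    (PiLp.continuous_apply (p := 2) (β := fun _ : Fin 3 => ℝ) p).abs

/-- … hence measurable. [folklore] -/
theorem measurable_testedVar : Measurable testedVar := continuous_testedVar.measurable

/-! ## §2 The fibre data on a unit direction: tail support, (DC-fwd) with constant `dim`, the tested variable as the
`sup'` of the norm profiles of two ENTIRE plaquette functionals [folklore] -/

section Fibre

variable {c : ℝ}

/-- on a unit direction the ray point at fibre coordinate `r` lies in the closed unit ball iff `0 ≤ r`. [folklore] -/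
theorem ray_mem_closedBall_iff {y : E3} (hy : ‖y‖ = 1) (r : ℝ) :
    Real.exp (-r) • y ∈ closedBall (0 : E3) 1 ↔ 0 ≤ r := by
  rw [mem_closedBall_zero_iff, norm_exp_neg_smul hy, Real.exp_le_one_iff, neg_nonpos]

/-- THE FIBRE DENSITY ON THE PHYSICAL TAIL: `e^{−n r}·exp(−c e^{−2r})` for `r ≥ 0`. [folklore] -/
theorem polarDensity_dens_of_nonneg {y : E3} (hy : ‖y‖ = 1) (n : ℝ) {r : ℝ} (hr : 0 ≤ r) :
    polarDensity n (dens c) (y, r) =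
      ENNReal.ofReal (Real.exp (-(n * r))) * ENNReal.ofReal (Real.exp (-(c * Real.exp (-2 * r)))) := by
  have e2 : Real.exp (-r) ^ 2 = Real.exp (-2 * r) := by
    rw [← Real.exp_nat_mul]; congr 1; push_cast; ring
  rw [polarDensity_of_norm_eq_one hy, dens, indicator_of_mem ((ray_mem_closedBall_iff hy r).2 hr),
    norm_exp_neg_smul hy, e2]

/-- TAIL SUPPORT: the fibre density vanishes below `r₀ = 0` (the ray has left the small-field ball). [folklore] -/
theorem polarDensity_dens_of_neg {y : E3} (hy : ‖y‖ = 1) (n : ℝ) {r : ℝ} (hr : r < 0) :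
    polarDensity n (dens c) (y, r) = 0 := by
  rw [polarDensity_of_norm_eq_one hy, dens,
    indicator_of_notMem (fun h => (not_le.2 hr) ((ray_mem_closedBall_iff hy r).1 h)), mul_zero]

/-- (DC-fwd) ON THE TAIL with constant EXACTLY the dimension `n`, by `fwdLogLipschitzOn_radialGaussianModel` BY NAME.
[folklore] -/
theorem fwd_polarDensity_dens (hc : 0 ≤ c) {y : E3} (hy : ‖y‖ = 1) (n : ℝ) :
    FwdLogLipschitzOn (fun r => polarDensity n (dens c) (y, r)) n (Ici 0) := by
  intro r hr r' hr' hrr'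
  simp only [polarDensity_dens_of_nonneg hy n (mem_Ici.1 hr), polarDensity_dens_of_nonneg hy n (mem_Ici.1 hr')]
  exact fwdLogLipschitzOn_radialGaussianModel hc (Ici 0) hr hr' hrr'

/-- THE TESTED VARIABLE ALONG THE RAY is the `sup'` over the tested plaquettes of the norm profiles (physical range
`r₀ = 0`) of the ENTIRE functions `w ↦ w·(ŷ p)` — for ALL `r`, the unit-rate continuation below `r₀` included,
because the functionals are exactly linear. [folklore] -/
theorem testedVar_dilate (y : E3) (r : ℝ) :
    (testedVar ∘ dilate) (y, r) = P.sup' P_nonempty fun p => normProfile (fun t : ℝ => (t : ℂ) * ((y p : ℝ) : ℂ)) 0 r := by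
  simp only [Function.comp_apply, dilate_apply, testedVar]
  refine Finset.sup'_congr _ rfl fun p _ => ?_
  have key : Real.exp (-(max r 0)) * Real.exp (max r 0 - r) = Real.exp (-r) := by
    rw [← Real.exp_add]; congr 1; ring
  rw [PiLp.smul_apply, smul_eq_mul, abs_mul, abs_of_pos (Real.exp_pos _), normProfile, norm_mul,
    Complex.norm_real, Complex.norm_real, Real.norm_eq_abs, Real.norm_eq_abs, abs_of_pos (Real.exp_pos _),
    mul_right_comm, key]

/-- a TRANSVERSAL direction: along `e₀` the tested variable is `e^{−r}` (reaches the shell). [folklore] -/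
theorem testedVar_dilate_single_zero (r : ℝ) : (testedVar ∘ dilate) (EuclideanSpace.single (0 : Fin 3) (1 : ℝ), r) = Real.exp (-r) := by
  simp only [Function.comp_apply, dilate_apply, testedVar]
  refine le_antisymm (Finset.sup'_le _ _ fun p hp => ?_) ?_
  · rcases mem_P.1 hp with rfl | rfl
    · simp [abs_of_pos (Real.exp_pos _)]
    · simp [Real.exp_nonneg]
  · have h := Finset.le_sup' (fun p : Fin 3 => |(Real.exp (-r) • EuclideanSpace.single (0 : Fin 3) (1 : ℝ)) p|)
      (show (0 : Fin 3) ∈ P from mem_P.2 (Or.inl rfl))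
    simpa [abs_of_pos (Real.exp_pos _)] using h

/-- an EXCEPTIONAL direction: along `e₂` (the untested degree of freedom) the tested variable vanishes identically, so
that fibre never meets a shell — the exceptional branch of the per-fibre alternative is exercised by the toy.
[folklore] -/
theorem testedVar_dilate_single_two (r : ℝ) : (testedVar ∘ dilate) (EuclideanSpace.single (2 : Fin 3) (1 : ℝ), r) = 0 := by
  simp only [Function.comp_apply, dilate_apply, testedVar]
  refine le_antisymm (Finset.sup'_le _ _ fun p hp => ?_) ?_
  · rcases mem_P.1 hp with rfl | rfl <;> simp
  · have h := Finset.le_sup' (fun p : Fin 3 => |(Real.exp (-r) • EuclideanSpace.single (2 : Fin 3) (1 : ℝ)) p|)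
      (show (0 : Fin 3) ∈ P from mem_P.2 (Or.inl rfl))
    simpa using h

/-! ## §3 The per-fibre alternative with EVERY binder discharged, and (M1) for the toy [folklore] -/

/-- **THE PER-FIBRE ALTERNATIVE ON EVERY UNIT DIRECTION, NO BINDER LEFT.**  `fibreAlternative_of_analytic_family`
BY NAME with: plaquette functionals `w ↦ w·(ŷ p)` (entire; radius `R = 1001`, bound `H = 1001`, vanishing at the flat
point), physical range `r₀ = 0`, smallness `s = 1/10` — (SM) reads `2·(9·1001/1000²)·1 ≤ (1/10)·(1/2)·(1 − ρ)`, true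
for `ρ ≤ 1/2` —, tail support and (DC-fwd) from §2; defect `s/(1 − 2s) = 1/8`, any onset `σ`, any window `L`.
[folklore] -/
theorem fibreAlternative_toy (hc : 0 ≤ c) {ρ : ℝ} (hρ2 : ρ ≤ 1 / 2) {y : E3} (hy : ‖y‖ = 1) (σ L : ℝ) :
    FibreAlternative (polarDensity (Module.finrank ℝ E3) (dens c)) (testedVar ∘ dilate) (1 / 8) σ
      (Module.finrank ℝ E3) (1 / 2) ρ L y := by
  have h1 : ∀ p : Fin 3, |y p| ≤ 1 := fun p => by
    have h := PiLp.norm_apply_le y p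
    rwa [Real.norm_eq_abs, hy] at h
  have h := fibreAlternative_of_analytic_family (Fd := polarDensity (Module.finrank ℝ E3 : ℝ) (dens c))
    (u := testedVar ∘ dilate) P_nonempty (f := fun p (w : ℂ) => w * ((y p : ℝ) : ℂ)) (R := 1001) (H := 1001) (r₀ := 0)
    (s := 1 / 10) (θ := 1 / 2) (ρ := ρ) (B := (Module.finrank ℝ E3 : ℝ)) (σ := σ) (L := L) y
    (by rw [neg_zero, Real.exp_zero]; norm_num)
    (fun p _ => (differentiable_id.mul_const _).differentiableOn)
    (fun p _ w hw => by
      rw [mem_ball_zero_iff] at hw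
      rw [norm_mul, Complex.norm_real, Real.norm_eq_abs]
      nlinarith [norm_nonneg w, abs_nonneg (y p), h1 p])
    (fun p _ => by simp)
    (by norm_num) (by norm_num) (by norm_num) (by linarith)
    (by simp only [neg_zero, Real.exp_zero, cauchyCoef]; norm_num; linarith)
    (fun r => testedVar_dilate y r)
    (fun r hr => polarDensity_dens_of_neg hy _ hr)
    (fwd_polarDensity_dens hc hy _)
  have e : (1 / 10 : ℝ) / (1 - 2 * (1 / 10)) = 1 / 8 := by norm_num
  rw [e] at h
  exact h

end Fibre

/-- THE WINDOW used: the admissible window of `T4ShellMeasureAnalytic.window_admissible` for `δ = 1/8`, `B = 3`,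
`ℓ₀ = −log(1 − ρ)` — gap `L/(1+δ) − ℓ₀/(1−δ) = 1/B = 1/3`. [folklore] -/
def Lwin (ρ : ℝ) : ℝ := (1 + 1 / 8) * (-Real.log (1 - ρ) / (1 - 1 / 8) + 1 / 3)

/-- THE SHELL CONSTANT of the toy: `2·fibreCoef (1/8) 3 (−log(1−ρ)) (Lwin ρ)`. [folklore] -/
def toyCoef (ρ : ℝ) : ℝ := 2 * fibreCoef (1 / 8) 3 (-Real.log (1 - ρ)) (Lwin ρ)

/-- **(M1) FOR THE TOY — `T4ShellMeasure.SlotAntiConcentration` WITH NO BINDER LEFT.**  For every `c ≥ 0` and every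
relative width `ρ ∈ [0, 1/2]`: the shell `{(1 − ρ)/2 ≤ testedVar < 1/2}` of the measure `𝟙{‖x‖ ≤ 1} e^{−c‖x‖²} dx` on `ℝ³`
has mass at most `toyCoef ρ · ρ ·` (total mass) — `slotAntiConcentration_withDensity` BY NAME, its per-fibre
hypothesis supplied by `fibreAlternative_toy`, the remaining numeric binders (`δ ∈ [0,1)`, `B ≥ 0`, `θ ≤ onset`,
`−log(1 − ρ) ≤ ℓ₀`, window gap `> 0`) discharged by arithmetic. [folklore] -/
theorem slotAntiConcentration_toy {c : ℝ} (hc : 0 ≤ c) {ρ : ℝ} (hρ0 : 0 ≤ ρ) (hρ2 : ρ ≤ 1 / 2) :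
    SlotAntiConcentration (μtoy c) testedVar (1 / 2) ρ (toyCoef ρ) := by
  have h := slotAntiConcentration_withDensity (volume : Measure E3) (measurable_dens c) measurable_testedVar
    (δ := 1 / 8) (s := 1 / 2) (B := (Module.finrank ℝ E3 : ℝ)) (θ := 1 / 2) (ρ := ρ)
    (ℓ₀ := -Real.log (1 - ρ)) (L := Lwin ρ)
    (by norm_num) (by norm_num) (by positivity) (by norm_num) le_rfl hρ0 hρ2 le_rfl
    (by unfold Lwin; ring_nf; norm_num)
    (fun y hy => fibreAlternative_toy hc hρ2 hy (1 / 2) (Lwin ρ))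
  have h3 : (Module.finrank ℝ E3 : ℝ) = 3 := by
    rw [show Module.finrank ℝ E3 = 3 from finrank_euclideanSpace_fin]; norm_num
  rw [h3] at h
  exact h

/-- THE CONSTANT IN CLOSED FORM: `toyCoef ρ = (96/7)·exp(1 + (48/7)·(−log(1 − ρ)))` (`fibreCoef_window_eq` BY
NAME) — `(96/7)·e ≈ 37` at `ρ → 0` and exponential in `B·ℓ₀ = 3·(−log(1−ρ))`, exactly the phase-space behaviour
recorded in `T4ShellMeasureAnalytic` §8; a witness of joint satisfiability, not of sharpness (the true shell
fraction of the toy is `O(ρ)` with an `O(1)` constant). [folklore] -/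
theorem toyCoef_eq (ρ : ℝ) : toyCoef ρ = 96 / 7 * Real.exp (1 + 48 / 7 * (-Real.log (1 - ρ))) := by
  unfold toyCoef Lwin
  rw [fibreCoef_window_eq (by norm_num) (by norm_num) (by norm_num)]
  have e : (1 : ℝ) + 2 * 3 * (-Real.log (1 - ρ)) / (1 - 1 / 8) = 1 + 48 / 7 * (-Real.log (1 - ρ)) := by ring
  rw [e]
  ring

/-! ## §4 Non-degeneracy of the witness: finite total mass, shell of positive mass [folklore] -/

/-- THE TOTAL MASS IS FINITE (so the right-hand side of (M1) is not `∞`): `dens c ≤ 𝟙{‖x‖ ≤ 1}`. [folklore] -/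
theorem μtoy_univ_lt_top {c : ℝ} (hc : 0 ≤ c) : μtoy c univ < ∞ := by
  rw [μtoy, withDensity_apply _ MeasurableSet.univ, Measure.restrict_univ]
  calc ∫⁻ x, dens c x ∂(volume : Measure E3)
      ≤ ∫⁻ x, (closedBall (0 : E3) 1).indicator 1 x ∂(volume : Measure E3) :=
        lintegral_mono fun x => Set.indicator_le_indicator
          (ENNReal.ofReal_le_one.2 (Real.exp_le_one_iff.2 (neg_nonpos.2 (mul_nonneg hc (sq_nonneg _)))))
    _ = volume (closedBall (0 : E3) 1) := lintegral_indicator_one measurableSet_closedBall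
    _ < ∞ := measure_closedBall_lt_top

/-- THE SHELL HAS POSITIVE MASS for `0 < ρ ≤ 1/2` (so the left-hand side of (M1) is not `0` and the bound is an
honest inequality between positive finite numbers): the shell contains the open set
`{(1 − ρ)/2 < testedVar < 1/2} ∩ {‖x‖ < 1}`, nonempty (it contains `(1/2 − ρ/4)·e₀`), on which the density is `≥ e^{−c}`.
[folklore] -/
theorem shell_pos {c : ℝ} (hc : 0 ≤ c) {ρ : ℝ} (hρ : 0 < ρ) (hρ2 : ρ ≤ 1 / 2) :
    0 < μtoy c {x | 1 / 2 * (1 - ρ) ≤ testedVar x ∧ testedVar x < 1 / 2} := by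
  have hSm : MeasurableSet {x : E3 | 1 / 2 * (1 - ρ) ≤ testedVar x ∧ testedVar x < 1 / 2} := measurable_testedVar measurableSet_Ico
  set U : Set E3 := {x | 1 / 2 * (1 - ρ) < testedVar x ∧ testedVar x < 1 / 2} ∩ ball 0 1 with hU
  have hUo : IsOpen U := (isOpen_Ioo.preimage continuous_testedVar).inter isOpen_ball
  have hUS : U ⊆ {x | 1 / 2 * (1 - ρ) ≤ testedVar x ∧ testedVar x < 1 / 2} := fun x hx => ⟨hx.1.1.le, hx.1.2⟩
  have ha : (0 : ℝ) < 1 / 2 - ρ / 4 := by linarith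
  have hUne : U.Nonempty := by
    refine ⟨EuclideanSpace.single (0 : Fin 3) (1 / 2 - ρ / 4), ⟨?_, ?_⟩, ?_⟩
    · show 1 / 2 * (1 - ρ) < P.sup' P_nonempty fun p => |(EuclideanSpace.single (0 : Fin 3) (1 / 2 - ρ / 4) : E3) p|
      refine lt_of_lt_of_le ?_ (Finset.le_sup'
        (fun p : Fin 3 => |(EuclideanSpace.single (0 : Fin 3) (1 / 2 - ρ / 4) : E3) p|) (mem_P.2 (Or.inl rfl)))
      simp only [PiLp.single_apply, if_true, abs_of_pos ha]
      linarith
    · show (P.sup' P_nonempty fun p => |(EuclideanSpace.single (0 : Fin 3) (1 / 2 - ρ / 4) : E3) p|) < 1 / 2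
      refine (Finset.sup'_lt_iff _).2 fun p hp => ?_
      rcases mem_P.1 hp with rfl | rfl
      · simp only [PiLp.single_apply, if_true, abs_of_pos ha]
        linarith
      · simp
    · rw [mem_ball_zero_iff, PiLp.norm_single, Real.norm_eq_abs, abs_of_pos ha]
      linarith
  have hlow : ∀ x ∈ U, ENNReal.ofReal (Real.exp (-c)) ≤ dens c x := by
    intro x hx
    have hx1 : ‖x‖ < 1 := mem_ball_zero_iff.1 hx.2
    rw [dens, indicator_of_mem (mem_closedBall_zero_iff.2 hx1.le)]
    refine ENNReal.ofReal_le_ofReal (Real.exp_le_exp.2 ?_)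
    have : ‖x‖ ^ 2 ≤ 1 := by nlinarith [norm_nonneg x]
    nlinarith
  rw [μtoy, withDensity_apply _ hSm]
  calc (0 : ℝ≥0∞) < ENNReal.ofReal (Real.exp (-c)) * volume U :=
        ENNReal.mul_pos (ENNReal.ofReal_pos.2 (Real.exp_pos _)).ne' (hUo.measure_pos volume hUne).ne'
    _ = ∫⁻ _ in U, ENNReal.ofReal (Real.exp (-c)) ∂(volume : Measure E3) := (setLIntegral_const _ _).symm
    _ ≤ ∫⁻ x in U, dens c x ∂(volume : Measure E3) := setLIntegral_mono (measurable_dens c) hlow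
    _ ≤ ∫⁻ x in {x | 1 / 2 * (1 - ρ) ≤ testedVar x ∧ testedVar x < 1 / 2}, dens c x ∂(volume : Measure E3) :=
        lintegral_mono_set hUS

/-- hence the total mass is positive too. [folklore] -/
theorem μtoy_univ_pos {c : ℝ} (hc : 0 ≤ c) : 0 < μtoy c univ :=
  lt_of_lt_of_le (shell_pos hc (by norm_num : (0 : ℝ) < 1 / 2) le_rfl) (measure_mono (subset_univ _))

/-- **THE WITNESS IN ONE STATEMENT.**  For every `c ≥ 0` and `ρ ∈ (0, 1/2]`: an honest instance of
`T4ShellMeasure.SlotAntiConcentration` — positive finite shell mass, positive finite total mass, explicit constant —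
obtained from the analytic member of the shell-measure frame with all of (AN-bound), (SM), tail support, (DC-fwd),
window, presentation discharged on one model. [folklore] -/
theorem witness {c : ℝ} (hc : 0 ≤ c) {ρ : ℝ} (hρ : 0 < ρ) (hρ2 : ρ ≤ 1 / 2) :
    SlotAntiConcentration (μtoy c) testedVar (1 / 2) ρ (96 / 7 * Real.exp (1 + 48 / 7 * (-Real.log (1 - ρ)))) ∧
      0 < μtoy c {x | 1 / 2 * (1 - ρ) ≤ testedVar x ∧ testedVar x < 1 / 2} ∧ μtoy c univ < ∞ :=
  ⟨toyCoef_eq ρ ▸ slotAntiConcentration_toy hc hρ.le hρ2, shell_pos hc hρ hρ2, μtoy_univ_lt_top hc⟩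

end

end Summit.QuantumFields.BalabanUV.T4Continuum.ShellMeasureWitness
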